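import Mathlib
import HarnessLib
import Summits.NavierStokesRegularity.NavierStokesRegularity.Theorems.HalfSpaceWindowDoorCirculationCarryingRigidityLedger
import Summits.NavierStokesRegularity.NavierStokesRegularity.Theorems.FilamentPinchDoorFilamentaryGrowthStubSignedMassOfSliceEnergy

/-!
# Route `HalfSpaceWindowDoor`, crux `CirculationCarryingRigidity` (stmt-NavierStokesRegularity-25311) — line `ledger`, Step 4:
# the FILAMENT LAW — `∫_{B_R(x)} ⟪curl v(s), e⟫ ≤ K_f(C)·‖e‖·R`, unconditionally in the door class

LEAD ns-hsw-p1 g12 (cell pub-ns-dss), `--supports stmt-NavierStokesRegularity-25311 --as helper`.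

THE POINT.  Route AxisTwistDoor's crux `FilamentaryGrowth` (stmt-NavierStokesRegularity-26431, PROVED as stated) says: in the
Albritton–Barker ENERGY CLASS (`IsSuitableWeakSolutionOn`, a weak spatial gradient, `typeIBound 𝐈 < ⊤` — all HYPOTHESES of that item)
non-negativity of `⟪curl v, e⟫` forces FILAMENTARY GROWTH `∫_{B_R(x)} ⟪curl v(s), e⟫ ≤ K·R` (cutoff, curl integrated by parts onto
the cutoff, Cauchy–Schwarz, slice Morrey bound `∫_{B_r}|v(s)|² ≲ 𝐈 r`; kinematic core
`…FilamentPinchDoorFilamentaryGrowthStubSignedMassOfSliceEnergy.lintegral_ball_inner_curl_le`).  The only energy-class input that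
proof consumes is the slice Morrey bound — which is EXACTLY the far-past energy ledger of the door class (`…Ledger.exists_ledger`, from
the tree theorem `Theorems.FarPastLedger_proof`).  Hence the filament law holds for EVERY profile of the route's time-only Type-I ancient
Oseen-mild class, with a constant depending on `C` only:

* `exists_lintegral_ball_inner_curl_le` — **FILAMENT LAW**: `∃ K_f = K_f(C) ≥ 0`, for every door-class profile `v`, every direction `e`
  with `⟪curl v(s), e⟫ ≥ 0` on the slab, every `s < 0`, centre `x`, radius `R > 0`:
  `∫⁻_{B_R(x)} ⟪curl v(s), e⟫ ≤ K_f · ‖e‖ · R`;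
* `exists_integral_ball_inner_curl_e3_le` — the `e₃`/Bochner form for closed-hemisphere profiles: `∫_{B_R(x)} ω₃(s) ≤ K_f · R`.

CENSUS READING (with Steps 1–3: `…LogEnergy`, `…Ledger`, `…LedgerSublinear`).  The signed vorticity of a W6-enemy has ONE-DIMENSIONAL
upper density at every scale, uniformly in time, centre and profile (only `C` enters): LAYERS (`∫_{B_R}ω₃ ≍ R²`) and VOLUMES (`≍ R³`) of
vertical vorticity are impossible in the door class itself — this is the `L¹`/ball companion of the rms circulation law (which carries
the extra `log`), and the unconditional form of the blow-down filament bound of line `blowdown` (`…GaussExtremalFilament`: `≤ 52 r M₀`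
only for `r ≤ √(2(−σ))`, in units of the enemy's own extremal mass).

WHAT THIS IS NOT: not a statement about Navier–Stokes regularity (Clay A); door statements are regularity CRITERIA about
HYPOTHETICAL blow-up profiles (KNSS ancient mild solutions); item 25311 stays OPEN at its research stub `stub_layerExclusion`; item 26431
of AxisTwistDoor is neither re-registered nor touched (its statement carries the energy-class hypotheses and is closed).
-/

noncomputable section

-- the summit and its single sub-problem share the name (CONVENTIONS §1), as in every Theorems file
set_option linter.dupNamespace false

namespace Summit.NavierStokesRegularity.NavierStokesRegularity.Theorems.HalfSpaceWindowDoorCirculationCarryingRigidityLedgerFilament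

open Set Function Filter MeasureTheory Topology Metric InnerProductSpace
open scoped ENNReal RealInnerProductSpace
open Literature.Analysis Literature.Analysis.FluidPDE
open Summit.NavierStokesRegularity.NavierStokesRegularity.Theorems.HalfSpaceWindowDoorCirculationCarryingRigidityDefs (InDoorClass)
open Summit.NavierStokesRegularity.NavierStokesRegularity.Theorems.HalfSpaceWindowDoorCirculationCarryingRigidityConeFluxSubsolution
  (contDiff_one_slice)
open Summit.NavierStokesRegularity.NavierStokesRegularity.Theorems.HalfSpaceWindowDoorCirculationCarryingRigidityLedger (exists_ledger)
open Summit.NavierStokesRegularity.NavierStokesRegularity.Theorems.FilamentPinchDoorFilamentaryGrowthStubSignedMassOfSliceEnergy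
  (exists_scaledBump lintegral_ball_inner_curl_le)

/-- The Bochner ledger in `lintegral` form on one slice: `∫⁻_{B_r(x)} ‖v(s)‖² ≤ K r`. -/
theorem lintegral_ball_normSq_le {C : ℝ} {v : ℝ → EuclideanSpace ℝ (Fin 3) → EuclideanSpace ℝ (Fin 3)} (hv : InDoorClass C v)
    {K : ℝ} (hK : ∀ t < 0, ∀ (x₀ : EuclideanSpace ℝ (Fin 3)) (R : ℝ), 0 < R → ∫ x in ball x₀ R, ‖v t x‖ ^ 2 ≤ K * R)
    {s : ℝ} (hs : s < 0) (x : EuclideanSpace ℝ (Fin 3)) {r : ℝ} (hr : 0 < r) :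
    ∫⁻ y in ball x r, ENNReal.ofReal (‖v s y‖ ^ 2) ≤ ENNReal.ofReal (K * r) := by
  have hvc : Continuous (v s) := (contDiff_one_slice hv hs).continuous
  have hint : IntegrableOn (fun y => ‖v s y‖ ^ 2) (ball x r) :=
    ((hvc.norm.pow 2).continuousOn.integrableOn_compact (isCompact_closedBall x r)).mono_set ball_subset_closedBall
  rw [← ofReal_integral_eq_lintegral_ofReal hint (Eventually.of_forall fun y => by positivity)]
  exact ENNReal.ofReal_le_ofReal (hK s hs x r hr)

/-- **THE FILAMENT LAW (door class, any signed direction).**  There is `K_f = K_f(C) ≥ 0` such that for every door-class profile `v`,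
every direction `e` with `⟪curl v(s), e⟫ ≥ 0` on the open lower slab, every `s < 0`, centre `x` and radius `R > 0`:
`∫⁻_{B_R(x)} ⟪curl v(s), e⟫ ≤ K_f · ‖e‖ · R`. -/
theorem exists_lintegral_ball_inner_curl_le (C : ℝ) : ∃ K_f : ℝ, 0 ≤ K_f ∧
    ∀ v : ℝ → EuclideanSpace ℝ (Fin 3) → EuclideanSpace ℝ (Fin 3), InDoorClass C v →
      ∀ e : EuclideanSpace ℝ (Fin 3), (∀ s < 0, ∀ y, 0 ≤ ⟪curl (v s) y, e⟫) →
        ∀ s < 0, ∀ (x : EuclideanSpace ℝ (Fin 3)) (R : ℝ), 0 < R →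
          ∫⁻ y in ball x R, ENNReal.ofReal ⟪curl (v s) y, e⟫ ≤ ENNReal.ofReal (K_f * ‖e‖ * R) := by
  obtain ⟨K, hK0, hK⟩ := exists_ledger C
  obtain ⟨L, hL0, hbump⟩ := exists_scaledBump
  set c₃ : ℝ := (volume (ball (0 : EuclideanSpace ℝ (Fin 3)) 1)).toReal with hc₃
  refine ⟨‖curlCLM‖ * L * (3 / 2 * K + 4 * c₃), by positivity, fun v hv e hnn s hs x R hR => ?_⟩
  have hw : ContDiff ℝ 1 (v s) := contDiff_one_slice hv hs
  obtain ⟨φ, hφ, hφc, hφ1, hφ0, hφs, hφL⟩ := hbump x R hR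
  have h := lintegral_ball_inner_curl_le hw (hnn s hs) hK0 (fun r hr => lintegral_ball_normSq_le hv (hK v hv) hs x hr)
    hR hφ hφc hφ1 hφ0 hφs hφL
  have e1 : ‖curlCLM‖ * L * ‖e‖ * (3 / 2 * K + 4 * c₃) * R = ‖curlCLM‖ * L * (3 / 2 * K + 4 * c₃) * ‖e‖ * R := by ring
  rwa [e1] at h

/-- **THE FILAMENT LAW, closed-hemisphere / Bochner form.**  There is `K_f = K_f(C) ≥ 0` such that every door-class profile with
`ω₃ = ⟪curl v, e₃⟫ ≥ 0` satisfies `∫_{B_R(x)} ω₃(s) ≤ K_f · R` for all `s < 0`, `x`, `R > 0`: the vertical vorticity has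
ONE-DIMENSIONAL upper density at every scale (no layers, no volumes). -/
theorem exists_integral_ball_inner_curl_e3_le (C : ℝ) : ∃ K_f : ℝ, 0 ≤ K_f ∧
    ∀ v : ℝ → EuclideanSpace ℝ (Fin 3) → EuclideanSpace ℝ (Fin 3), InDoorClass C v →
      (∀ s < 0, ∀ y, 0 ≤ ⟪curl (v s) y, (EuclideanSpace.single (2 : Fin 3) (1 : ℝ))⟫) →
        ∀ s < 0, ∀ (x : EuclideanSpace ℝ (Fin 3)) (R : ℝ), 0 < R →
          ∫ y in ball x R, ⟪curl (v s) y, (EuclideanSpace.single (2 : Fin 3) (1 : ℝ))⟫ ≤ K_f * R := by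
  obtain ⟨K_f, hKf0, hKf⟩ := exists_lintegral_ball_inner_curl_le C
  refine ⟨K_f, hKf0, fun v hv hnn s hs x R hR => ?_⟩
  set e : EuclideanSpace ℝ (Fin 3) := EuclideanSpace.single (2 : Fin 3) (1 : ℝ) with he
  have hne : ‖e‖ = 1 := by simp [he]
  have h := hKf v hv e hnn s hs x R hR
  rw [hne, mul_one] at h
  -- the integrand is continuous (the slice is `C¹`), hence integrable on the ball
  have hw : ContDiff ℝ 1 (v s) := contDiff_one_slice hv hs
  have hcurl : Continuous fun y => ⟪curl (v s) y, e⟫ := by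
    have hw' : ContDiff ℝ ((0 : ℕ∞) + 1) (v s) := by simpa using hw
    have hc : Continuous (curl (v s)) := (contDiff_curl hw').continuous
    exact hc.inner continuous_const
  have hint : IntegrableOn (fun y => ⟪curl (v s) y, e⟫) (ball x R) :=
    (hcurl.continuousOn.integrableOn_compact (isCompact_closedBall x R)).mono_set ball_subset_closedBall
  have hnn' : 0 ≤ᵐ[volume.restrict (ball x R)] fun y => ⟪curl (v s) y, e⟫ :=
    Eventually.of_forall fun y => hnn s hs y
  rw [← ofReal_integral_eq_lintegral_ofReal hint hnn'] at h
  exact (ENNReal.ofReal_le_ofReal_iff (by positivity)).1 h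

end Summit.NavierStokesRegularity.NavierStokesRegularity.Theorems.HalfSpaceWindowDoorCirculationCarryingRigidityLedgerFilament

end
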